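import Literature.Computability.Complexity.Classes
import Literature.Computability.Complexity.ProbabilisticClasses
import Literature.Computability.Complexity.CircuitClasses
import Literature.Computability.Complexity.Counting
import Literature.Computability.Complexity.PolyHierarchy
import Literature.Computability.Complexity.Space
import HarnessLib

/-!
# Wagner's counting hierarchy `CH`

Trunk `CplxCore`. The (polynomial) counting hierarchy of Wagner (1986), defined as in
Bürgisser (ECCC TR06-113 = Comput. Complexity 18 (2009), §2.1) by iterating a counting operator on
the class `P`:

* `CkP k` — the `k`-th level `CₖP`: `C₀P = P`, `Cₖ₊₁P = C'·CₖP`, where `C'·` is the *majority*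
  counting operator, i.e. the library's `pMajority` (strictly more than half of the strings
  `y ∈ {0,1}^{p |x|}` have `⟨x, y⟩ ∈ B`). Bürgisser's Definition 2.1 uses Wagner's threshold
  operator `C·` (`#{y | ⟨x,y⟩ ∈ B} > f x` for a polynomial-time `f`); by Torán (1991) both
  operators generate the same levels `CₖP` (Bürgisser 2009, remark after Def. 2.3), and the
  majority form is the one used in Bürgisser's proof of Lemma 2.5, so we take it as the
  definition. In particular `C₁P = PP` holds by `rfl`.
* `CH = ⋃ₖ CₖP`.
* `PPRelClass C = ⋃_{B ∈ C} PP^B`, to state Torán's oracle characterisation `Cₖ₊₁P = PP^{CₖP}`.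

Proved API: unfolding lemmas, `CkP_subset_CH`, `P_subset_CH`-style inclusions that are
definitional, and the first half of Bürgisser's Lemma 2.5 (`PP = P → CH = P`, a two-line
induction). Named facts (D-0014), each a `def … : Prop` with its cite: cumulativity
`CₖP ⊆ Cₖ₊₁P`, `PH ⊆ CH ⊆ PSPACE`, Torán's characterisation, and the second half of Lemma 2.5
(`PP ⊆ P/poly → CH ⊆ P/poly`), whose printed proof swaps advice and majority quantifier and needs
closure of `P` under a polynomial-time re-pairing (machine constructions the library keeps as
named facts, cf. `PPoly_eq_polyAdvice_P`).

Mathlib has no complexity classes beyond `Turing.TM2ComputableInPolyTime` (searched `CH`,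
`counting hierarchy`, `Wagner`, `PP`: nothing); the tree had `PP`, `pMajority`, `SharpP`, `PH`,
`PSPACE`, `PPoly`, `polyAdvice` but no `CH` (searched `CountingHierarchy`, `counting hierarchy`).

## References

* K. W. Wagner, *The complexity of combinatorial problems with succinct input representation*,
  Acta Inform. 23 (1986) 325–356 (definition of `CH` via the counting operator `C`).
* J. Torán, *Complexity classes defined by counting quantifiers*, J. ACM 38 (1991) 753–774,
  §3–4 (majority operator gives the same classes; `Cₖ₊₁P = PP^{CₖP}`; cumulativity).
* E. Allender, K. W. Wagner, *Counting hierarchies: polynomial time and constant depth circuits*,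
  in: Current Trends in Theoretical Computer Science, World Scientific 1993, 469–483.
* P. Bürgisser, *On defining integers in the counting hierarchy and proving lower bounds in
  algebraic complexity*, ECCC TR06-113 (2006), §2.1, Def. 2.1–2.4, Lemma 2.5; journal version
  *On defining integers and proving arithmetic circuit lower bounds*, Comput. Complexity 18
  (2009) 81–103.
-/

namespace Literature.Computability.Complexity

/-! ### The levels `CₖP` and the class `CH` -/

/-- The `k`-th level `CₖP` of Wagner's counting hierarchy: `C₀P = P` and `Cₖ₊₁P = C'·CₖP`, the
majority counting operator `pMajority` applied to the previous level (Bürgisser, ECCC TR06-113,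
Def. 2.3 with the majority variant `C'` of Def. 2.1, equivalent by Torán 1991; Wagner 1986). [cite: Burgisser2006, Def. 2.3] -/
noncomputable def CkP : ℕ → Set (Language Bool)
  | 0 => Classes.P
  | k + 1 => pMajority (CkP k)

/-- Wagner's counting hierarchy `CH = ⋃ₖ CₖP` (Wagner 1986; Bürgisser, ECCC TR06-113, Def. 2.3). [cite: Burgisser2006, Def. 2.3] -/
noncomputable def CH : Set (Language Bool) :=
  ⋃ k : ℕ, CkP k

/-- The relativised class `PP^C = ⋃_{B ∈ C} PP^B` for a class `C` of oracle languages
(Torán 1991, §4; Bürgisser, ECCC TR06-113, (3)). [cite: Toran1991, §4] -/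
noncomputable def PPRelClass (C : Set (Language Bool)) : Set (Language Bool) :=
  ⋃ B ∈ C, PPRel (Oracle.ofLanguage B)

/-! ### Unfolding lemmas and definitional inclusions -/

/-- `C₀P = P` (definitional; Bürgisser, ECCC TR06-113, Def. 2.3). [cite: Burgisser2006, Def. 2.3] -/
@[simp]
theorem CkP_zero : CkP 0 = Classes.P :=
  rfl

/-- `Cₖ₊₁P = C'·CₖP = pMajority (CₖP)` (definitional; Bürgisser, ECCC TR06-113, Def. 2.3). [cite: Burgisser2006, Def. 2.3] -/
theorem CkP_succ (k : ℕ) : CkP (k + 1) = pMajority (CkP k) :=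
  rfl

/-- `C₁P = PP` (Bürgisser, ECCC TR06-113, §2.1: "we obtain for `k = 1` the definition of the
familiar class PP"; here definitional since `PP = pMajority P`). [cite: Burgisser2006, §2.1] -/
theorem CkP_one : CkP 1 = PP :=
  rfl

/-- Every level is contained in `CH` (definitional). [cite: Burgisser2006, Def. 2.3] -/
theorem CkP_subset_CH (k : ℕ) : CkP k ⊆ CH :=
  Set.subset_iUnion CkP k

/-- Membership in `CH` unfolds to membership in some level (definitional). [cite: Burgisser2006, Def. 2.3] -/
theorem mem_CH_iff {L : Language Bool} : L ∈ CH ↔ ∃ k, L ∈ CkP k :=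
  Set.mem_iUnion

/-- `P = C₀P ⊆ CH`. [cite: Burgisser2006, Def. 2.3] -/
theorem P_subset_CH : Classes.P ⊆ CH :=
  CkP_subset_CH 0

/-- `PP = C₁P ⊆ CH` (Bürgisser, ECCC TR06-113, §2.1). [cite: Burgisser2006, §2.1] -/
theorem PP_subset_CH : PP ⊆ CH :=
  CkP_subset_CH 1

/-- `CH` is closed under the majority operator: `C'·CH ⊆ CH`, since a witness language
`B ∈ CH` lies in some `CₖP` and then the new language lies in `Cₖ₊₁P` (immediate from the
definitions; Torán 1991, §3). [cite: Toran1991, §3] -/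
theorem pMajority_CH_subset : pMajority CH ⊆ CH := by
  rintro L ⟨B, hB, p, hp⟩
  obtain ⟨k, hk⟩ := mem_CH_iff.1 hB
  exact CkP_subset_CH (k + 1) ⟨B, hk, p, hp⟩

/-! ### Bürgisser's Lemma 2.5 -/

/-- **Bürgisser's Lemma 2.5, first part**: the counting hierarchy collapses to `P` if `PP = P`
(induction on the level: `Cₖ₊₁P = C'·CₖP = C'·P = PP = P`) (Bürgisser, ECCC TR06-113,
Lemma 2.5). [cite: Burgisser2006, Lemma 2.5] -/
theorem CH_eq_P_of_PP_eq_P (h : PP = Classes.P) : CH = Classes.P := by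
  have hk : ∀ k, CkP k = Classes.P := by
    intro k
    induction k with
    | zero => rfl
    | succ k ih => rw [CkP_succ, ih]; exact h
  refine Set.Subset.antisymm ?_ P_subset_CH
  intro L hL
  obtain ⟨k, hL⟩ := mem_CH_iff.1 hL
  rwa [hk k] at hL

/-- **Bürgisser's Lemma 2.5, second part**: `PP ⊆ P/poly` implies `CH ⊆ P/poly`. Printed proof:
induction on `k`; for `A ∈ Cₖ₊₁P = C'·CₖP` with witness language `B ∈ CₖP ⊆ P/poly`, write
`z ∈ B ↔ ⟨z, α(|z|)⟩ ∈ D` with `D ∈ P`; then `x ∈ A` iff a majority of `y ∈ {0,1}^{p(n)}` has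
`⟨⟨x,y⟩, α(n + p(n))⟩ ∈ D`, so `A ∈ PP/poly ⊆ (P/poly)/poly = P/poly` (Bürgisser, ECCC TR06-113,
Lemma 2.5). Named fact (D-0014): the re-pairing step needs closure of `P` under a
polynomial-time transduction and `P/poly = P/poly-advice` (`PPoly_eq_polyAdvice_P`), which the
library keeps as named facts. [cite: Burgisser2006, Lemma 2.5] -/
def CH_subset_PPoly_of_PP_subset_PPoly : Prop :=
  PP ⊆ PPoly → CH ⊆ PPoly

/-! ### Structural facts about `CH` (named facts, D-0014) -/

/-- Cumulativity of the counting hierarchy: `CₖP ⊆ Cₖ₊₁P` for every `k` (ignore the counting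
quantifier: `K ⊆ C·K` for every reasonable class `K`; Bürgisser, ECCC TR06-113, Remark 2.2;
Torán 1991, §3). Named fact: needs closure of each level under pairing with a dummy string. [cite: Burgisser2006, Remark 2.2] -/
def CkP_subset_CkP_succ : Prop :=
  ∀ k : ℕ, CkP k ⊆ CkP (k + 1)

/-- The polynomial hierarchy is contained in the counting hierarchy, `PH ⊆ CH`, since
`∃·K ⊆ C·K` and `∀·K ⊆ C·K` (Bürgisser, ECCC TR06-113, §2.1, from Remark 2.2; Torán 1991,
§3). [cite: Burgisser2006, §2.1] -/
def PH_subset_CH : Prop :=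
  PH ⊆ CH

/-- `CH ⊆ PSPACE` (count the witnesses one by one in polynomial space; Bürgisser, ECCC
TR06-113, §2.1: "it is not hard to see that CH is contained in the class PSPACE"; Wagner 1986). [cite: Burgisser2006, §2.1] -/
def CH_subset_PSPACE : Prop :=
  CH ⊆ PSPACE

/-- **Torán's characterisation** of the counting hierarchy by oracles: `Cₖ₊₁P = PP^{CₖP}` for
every `k` (Torán 1991, §4; quoted as (3) in Bürgisser, ECCC TR06-113, §2.1). [cite: Toran1991, §4] -/
def CkP_succ_eq_PPRelClass : Prop :=
  ∀ k : ℕ, CkP (k + 1) = PPRelClass (CkP k)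

/-- `#P` functions can be evaluated bitwise in `CH`: for `g ∈ #P` the language
`{⟨x, bin j⟩ | bit j of g x is 1}` is in `CH` (indeed in `P^{PP} ⊆ C₂P`; Bürgisser, ECCC TR06-113,
§2.1: "functions in #P can be evaluated in polynomial time by oracle calls to PP", with (3)).
Stated with `Computability.encodeNat` for the binary index. [cite: Burgisser2006, §2.1] -/
def sharpP_bits_mem_CH : Prop :=
  ∀ g ∈ SharpP,
    {z : List Bool | ∃ x j, z = boolPair x (Computability.encodeNat j) ∧ (g x).testBit j = true} ∈ CH

end Literature.Computability.Complexity
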